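import Summits.HodgeConjecture.CorCM.DihedralReflexTripleDegrees
import HarnessLib

/-!
# The dihedral surface triple: at least FOUR independent exceptional `(2,2)`-classes on `S₁ × S₂ × S₁′` — one for each
# complex embedding of `K` (`dim B² − dim D² ≥ 4`; the toy census gives `= 4`)

COR-CM (cell `pub-hodgecm2`, seat p2 gen 19, count-neutral claim DIHEDRAL-TRIPLE, sequel of `DihedralReflexTripleCMHodge`
and `DihedralReflexTripleDegrees`); NEW as stated, hence under `Summits/`.  Theorems only; no definition, no named fact,
no `sorry`.

The exceptional Pohlmann `4`-set `P = {(0,p), (1,u), (1,v), (2,p′∘e)}` of `DihedralReflexTripleBalancedSet` meets the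
slot `Hom(K₀, ℂ)` in the single embedding `p`.  Galois translates of exceptional sets are exceptional
(`smul_finset_mem_diff`: balancedness is invariant, `CMWeights.isGaloisBalancedAlg_smul`, and «not conjugation-stable» is
transported since `τ` commutes with `ρ`), and `Aut(ℂ)` is transitive on `Hom(K₀, ℂ)`
(`Pohlmann1968.isPretransitive_ringEquiv_complex`); the four translates `τ_s P` with `τ_s p = s`, `s ∈ Hom(K₀, ℂ)`, are
pairwise distinct (they meet `Hom(K₀, ℂ)` in `{s}`).  Hence:

* `exists_mem_diff_two_slot_zero_eq` — an exceptional `4`-set whose slot-`0` part is ONE prescribed-shape point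
  (the construction of `DihedralReflexTripleCMHodge.pohlmannSetsAlg_two_diff_nonempty`, with the point exposed);
* **`four_le_ncard_diff_two`** — `4 ≤ #(pohlmannSetsAlg Φ 2 ∖ pohlmannDivisorSetsAlg Φ 2)`;
* **`four_le_finrank_hodgeClassSpan_sub`** — for every family of realisations,
  `4 ≤ dim_ℂ B²(S₁ × S₂ × S₁′) ⊗ ℂ − dim_ℂ D²(S₁ × S₂ × S₁′) ⊗ ℂ` (White's count, by name).
The toy census `Census/DihedralSurfaceTriple` (not imported) has exactly `4 = 19 − 15`, one `D₄`-orbit; the matching upper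
bound for general `D₄` fields is not proved here.

## References
* [Pohlmann1968] H. Pohlmann, Ann. of Math. 88 (1968) 161–180, Thm. 1.
* [Gordon1999HodgeAVSurvey] B. B. Gordon, *A survey of the Hodge conjecture for abelian varieties*, 9.2.2.
* [MoonenZarhin1999LowDim] B. Moonen, Yu. Zarhin, Math. Ann. 315 (1999) 711–733.
-/

noncomputable section

open CategoryTheory CategoryTheory.Limits NumberField NumberField.ComplexEmbedding IntermediateField
open scoped BigOperators Pointwise

namespace Summit.HodgeConjecture.CorCM

open Literature.NumberTheory.ComplexMultiplication
open Literature.NumberTheory.ComplexMultiplication.CMTypeOps (mem_iff_conjugate_notMem conjugate_mem_iff_notMem)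
open Literature.AlgebraicGeometry.Motives (AbelianVariety CMType)
open Literature.AlgebraicGeometry.HodgeTheory
open Literature.AlgebraicGeometry.ComplexMultiplication (IsCMTypeRealisation)
open Literature.AlgebraicGeometry.VanGeemen1994 (hodgeClassSpan)
open Literature.AlgebraicGeometry.Pohlmann1968
open Literature.Barriers.HodgeConjecture (divisorClassesSpan)
open CMWeights QuarticCM QuarticCMPairs DihedralReflexPair

namespace DihedralReflexTriple

/-! ### §1 Galois translates of (exceptional) Pohlmann sets -/

section Generic

variable {n : ℕ} {K : Fin n → Type} [∀ i, Field (K i)] [∀ i, NumberField (K i)] [∀ i, IsCMField (K i)]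

omit [∀ i, NumberField (K i)] [∀ i, IsCMField (K i)] in
open scoped Classical in
/-- A Galois translate of a Pohlmann `2p`-set is a Pohlmann `2p`-set. [cite: Gordon1999HodgeAVSurvey, 9.2.2] -/
theorem smul_finset_mem_pohlmannSetsAlg {Φ : ∀ i, CMType (K i)} {p : ℕ} {S : Finset ((i : Fin n) × (K i →+* ℂ))}
    (hS : S ∈ pohlmannSetsAlg Φ p) (τ : ℂ ≃+* ℂ) : τ • S ∈ pohlmannSetsAlg Φ p :=
  ⟨by rw [Finset.card_smul_finset, hS.1], isGaloisBalancedAlg_smul hS.2 τ⟩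

open scoped Classical in
/-- **Galois translates of exceptional Pohlmann sets are exceptional** (separating family): `τ` commutes with complex
conjugation on `⊔_i Hom(K_i, ℂ)`, so «not conjugation-stable» is transported. [cite: Gordon1999HodgeAVSurvey, 9.2.2] -/
theorem smul_finset_mem_diff {Φ : ∀ i, CMType (K i)} (hsep : CMAlgebra.IsSeparatingFamily Φ) {p : ℕ}
    {S : Finset ((i : Fin n) × (K i →+* ℂ))} (hS : S ∈ pohlmannSetsAlg Φ p \ pohlmannDivisorSetsAlg Φ p)
    (τ : ℂ ≃+* ℂ) : τ • S ∈ pohlmannSetsAlg Φ p \ pohlmannDivisorSetsAlg Φ p := by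
  obtain ⟨x, hx, hx'⟩ := (mem_diff_iff_not_conj_stable hsep hS.1).1 hS
  refine (mem_diff_iff_not_conj_stable hsep (smul_finset_mem_pohlmannSetsAlg hS.1 τ)).2
    ⟨τ • x, Finset.smul_mem_smul_finset hx, fun h => hx' ?_⟩
  rw [← smul_conj_smul_comm, Finset.smul_mem_smul_finset_iff] at h
  exact h

end Generic

/-! ### §2 Four pairwise distinct exceptional `4`-sets of the triple -/

section Triple

variable {K : Fin 3 → Type} [∀ j, Field (K j)] [∀ j, NumberField (K j)] [∀ j, IsCMField (K j)]

open scoped Classical in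
/-- **An exceptional `4`-set meeting `Hom(K₀, ℂ)` in exactly one point** — the set of
`DihedralReflexTripleCMHodge.pohlmannSetsAlg_two_diff_nonempty` (`{(0,p), (1,u), (1,v), (2,p′∘e)}`), with its slot-`0` point
`p` exposed. [cite: Pohlmann1968, Thm. 1] [cite: MoonenZarhin1999LowDim, "Hodge groups of simple abelian surfaces of
CM-type"] -/
theorem exists_mem_diff_two_slot_zero_eq (h4₀ : Module.finrank ℚ (K 0) = 4) (hK₀ : ¬IsGalois ℚ (K 0))
    (h4₁ : Module.finrank ℚ (K 1) = 4) (hK₁ : ¬IsGalois ℚ (K 1))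
    (hMK : ∀ (t : K 1 →+* ℂ) (y : K 1), t y ∈ normalClosure ℚ (K 0) ℂ) (hne : IsEmpty (K 1 →+* K 0))
    (e : K 2 ≃+* K 0) {Φ : ∀ j, CMType (K j)} (hsep : CMAlgebra.IsSeparatingFamily Φ) :
    ∃ S ∈ pohlmannSetsAlg Φ 2 \ pohlmannDivisorSetsAlg Φ 2, ∃ p : K 0 →+* ℂ,
      ∀ s : K 0 →+* ℂ, (⟨0, s⟩ : (j : Fin 3) × (K j →+* ℂ)) ∈ S ↔ s = p := by
  -- the data of §1–§3 of `DihedralReflexTripleCMHodge` (same construction)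
  obtain ⟨u, v, hvu, hvu', hΨ⟩ := exists_mem_mem_ne h4₁ (Φ 1)
  obtain ⟨σ, hσu, hσv⟩ := exists_swap h4₁ hK₁ hvu hvu'
  obtain ⟨q, hq⟩ := exists_smul_eq_self_of_swap h4₀ hK₀ h4₁ hMK hne hvu hvu' hσu hσv
  have hKM := apply_mem_normalClosure_partner h4₀ hK₀ h4₁ hK₁ hMK
  have hstab : ∀ γ : ℂ ≃+* ℂ, γ • q = q ↔ (γ • u = u ∧ γ • v = v) ∨ (γ • u = v ∧ γ • v = u) :=
    smul_eq_self_iff_of_swap h4₀ h4₁ hMK hKM hvu hvu' hσu hσv hq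
  obtain ⟨o, hoq, hoq'⟩ := exists_ne_ne_conjugate h4₀ q
  obtain ⟨a, b, hba, hba', hΦ0⟩ := exists_mem_mem_ne h4₀ (Φ 0)
  obtain ⟨hn1, hn2⟩ := not_mem_and_mem_of_isSeparatingFamily (i₀ := (0 : Fin 3)) (i₁ := (2 : Fin 3))
    (by simp) h4₀ e hsep hba hba' hΦ0
  have hR : ∀ s : K 0 →+* ℂ, (conjugate s).comp e.toRingHom ∈ (Φ 2).1 ↔ s.comp e.toRingHom ∉ (Φ 2).1 :=
    fun s => by rw [← conjugate_comp_ringEquiv]; exact conjugate_mem_iff_notMem _ _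
  have hAc : ∀ s : K 0 →+* ℂ, (s ∈ (Φ 0).1 ↔ s.comp e.toRingHom ∈ (Φ 2).1) →
      (conjugate s ∈ (Φ 0).1 ↔ (conjugate s).comp e.toRingHom ∈ (Φ 2).1) := fun s h => by
    rw [hR s, conjugate_mem_iff_notMem]
    exact not_congr h
  have hAc' : ∀ s : K 0 →+* ℂ, (conjugate s ∈ (Φ 0).1 ↔ (conjugate s).comp e.toRingHom ∈ (Φ 2).1) →
      (s ∈ (Φ 0).1 ↔ s.comp e.toRingHom ∈ (Φ 2).1) := fun s h => by
    have h' := hAc (conjugate s) h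
    rwa [involutive_conjugate] at h'
  have ha0 : a ∈ (Φ 0).1 := (hΦ0 a).2 (Or.inl rfl)
  have hb0 : b ∈ (Φ 0).1 := (hΦ0 b).2 (Or.inr rfl)
  have hdiff : ∃ s, ¬(s ∈ (Φ 0).1 ↔ s.comp e.toRingHom ∈ (Φ 2).1) := by
    by_cases h : a.comp e.toRingHom ∈ (Φ 2).1
    · exact ⟨b, fun hb => hn1 ⟨h, hb.1 hb0⟩⟩
    · exact ⟨a, fun ha => h (ha.1 ha0)⟩
  have hagree : ∃ s, (s ∈ (Φ 0).1 ↔ s.comp e.toRingHom ∈ (Φ 2).1) := by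
    by_cases h : (conjugate a).comp e.toRingHom ∈ (Φ 2).1
    · refine ⟨b, iff_of_true hb0 ?_⟩
      by_contra hb
      exact hn2 ⟨h, (hR b).2 hb⟩
    · exact ⟨a, iff_of_true ha0 (not_not.1 fun ha => h ((hR a).2 ha))⟩
  obtain ⟨p, hp, hpΦ⟩ : ∃ p, (p = q ∨ p = conjugate q) ∧ p ∉ (Φ 0).1 := by
    by_cases h : q ∈ (Φ 0).1
    · exact ⟨conjugate q, Or.inr rfl, (mem_iff_conjugate_notMem _ q).1 h⟩
    · exact ⟨q, Or.inl rfl, h⟩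
  have hσp : σ • p = p := by
    rcases hp with rfl | rfl
    · exact hq
    · rw [smul_conjugate, hq]
  -- the slot-`0` part of `{(0,p), (1,u), (1,v), (2,w)}` is `{p}`
  have slot0 : ∀ (w : K 2 →+* ℂ) (s : K 0 →+* ℂ),
      (⟨0, s⟩ : (j : Fin 3) × (K j →+* ℂ)) ∈
        ({⟨0, p⟩, ⟨1, u⟩, ⟨1, v⟩, ⟨2, w⟩} : Finset ((j : Fin 3) × (K j →+* ℂ))) ↔ s = p := by
    intro w s
    simp only [Finset.mem_insert, Finset.mem_singleton, Sigma.mk.inj_iff, heq_eq_eq, true_and]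
    constructor
    · rintro (h | ⟨h, -⟩ | ⟨h, -⟩ | ⟨h, -⟩)
      · exact h
      all_goals exact absurd h (by simp)
    · exact fun h => Or.inl h
  by_cases hAq : (q ∈ (Φ 0).1 ↔ q.comp e.toRingHom ∈ (Φ 2).1)
  · have hAp : (p ∈ (Φ 0).1 ↔ p.comp e.toRingHom ∈ (Φ 2).1) := by
      rcases hp with rfl | rfl
      · exact hAq
      · exact hAc q hAq
    have hp'Φ : p.comp e.toRingHom ∉ (Φ 2).1 := fun h => hpΦ (hAp.2 h)
    have hKo : ∀ w, w = o ∨ w = conjugate o → (w ∈ (Φ 0).1 ↔ w.comp e.toRingHom ∉ (Φ 2).1) := by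
      obtain ⟨s, hs⟩ := hdiff
      have hso : ¬(o ∈ (Φ 0).1 ↔ o.comp e.toRingHom ∈ (Φ 2).1) := by
        rcases eq_or_eq_or_eq_or_eq h4₀ hoq hoq' s with rfl | rfl | rfl | rfl
        · exact absurd hAq hs
        · exact absurd (hAc q hAq) hs
        · exact hs
        · exact fun ho => hs (hAc o ho)
      have hsō : ¬(conjugate o ∈ (Φ 0).1 ↔ (conjugate o).comp e.toRingHom ∈ (Φ 2).1) :=
        fun h => hso (hAc' o h)
      intro w hw
      rcases hw with rfl | rfl
      · exact ⟨fun ha hb => hso (iff_of_true ha hb), fun hb => by_contra fun ha => hso (iff_of_false ha hb)⟩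
      · exact ⟨fun ha hb => hsō (iff_of_true ha hb), fun hb => by_contra fun ha => hsō (iff_of_false ha hb)⟩
    exact ⟨_, ⟨mem_pohlmannSetsAlg_two h4₀ Φ e hvu hΨ hoq hoq' hstab hp hpΦ hp'Φ (Or.inl ⟨rfl, hKo⟩),
      not_mem_pohlmannDivisorSetsAlg_two h4₁ hK₁ Φ e hvu hvu' hΨ hσu hσv hσp hpΦ hp'Φ⟩, p, slot0 _⟩
  · have hAp : ¬(p ∈ (Φ 0).1 ↔ p.comp e.toRingHom ∈ (Φ 2).1) := by
      rcases hp with rfl | rfl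
      · exact hAq
      · exact fun h => hAq (hAc' q h)
    have hp'Φ : (conjugate p).comp e.toRingHom ∉ (Φ 2).1 := by
      rw [hR, not_not]
      by_contra h
      exact hAp (iff_of_false hpΦ h)
    have hKo : ∀ w, w = o ∨ w = conjugate o → (w ∈ (Φ 0).1 ↔ w.comp e.toRingHom ∈ (Φ 2).1) := by
      obtain ⟨s, hs⟩ := hagree
      have hso : (o ∈ (Φ 0).1 ↔ o.comp e.toRingHom ∈ (Φ 2).1) := by
        rcases eq_or_eq_or_eq_or_eq h4₀ hoq hoq' s with rfl | rfl | rfl | rfl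
        · exact absurd hs hAq
        · exact absurd (hAc' q hs) hAq
        · exact hs
        · exact hAc' o hs
      intro w hw
      rcases hw with rfl | rfl
      · exact hso
      · exact hAc o hso
    exact ⟨_, ⟨mem_pohlmannSetsAlg_two h4₀ Φ e hvu hΨ hoq hoq' hstab hp hpΦ hp'Φ (Or.inr ⟨rfl, hKo⟩),
      not_mem_pohlmannDivisorSetsAlg_two h4₁ hK₁ Φ e hvu hvu' hΨ hσu hσv hσp hpΦ hp'Φ⟩, p, slot0 _⟩

open scoped Classical in
/-- **At least four exceptional Pohlmann `4`-sets** — the translates `τ_s • P` (`τ_s p = s`) over the four complex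
embeddings `s` of `K₀`, pairwise distinct as they meet `Hom(K₀, ℂ)` in `{s}`. [cite: Pohlmann1968, Thm. 1]
[cite: Gordon1999HodgeAVSurvey, 9.2.2] -/
theorem four_le_ncard_diff_two (h4₀ : Module.finrank ℚ (K 0) = 4) (hK₀ : ¬IsGalois ℚ (K 0))
    (h4₁ : Module.finrank ℚ (K 1) = 4) (hK₁ : ¬IsGalois ℚ (K 1))
    (hMK : ∀ (t : K 1 →+* ℂ) (y : K 1), t y ∈ normalClosure ℚ (K 0) ℂ) (hne : IsEmpty (K 1 →+* K 0))
    (e : K 2 ≃+* K 0) {Φ : ∀ j, CMType (K j)} (hsep : CMAlgebra.IsSeparatingFamily Φ) :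
    4 ≤ (pohlmannSetsAlg Φ 2 \ pohlmannDivisorSetsAlg Φ 2).ncard := by
  obtain ⟨S, hS, p, hSp⟩ := exists_mem_diff_two_slot_zero_eq h4₀ hK₀ h4₁ hK₁ hMK hne e hsep
  haveI := isPretransitive_ringEquiv_complex (K := K 0)
  -- `τ_s` with `τ_s p = s`
  choose τ hτ using fun s : K 0 →+* ℂ => MulAction.exists_smul_eq (ℂ ≃+* ℂ) p s
  have hmem : ∀ s s' : K 0 →+* ℂ, (⟨0, s'⟩ : (j : Fin 3) × (K j →+* ℂ)) ∈ τ s • S ↔ s' = s := by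
    intro s s'
    rw [show (⟨0, s'⟩ : (j : Fin 3) × (K j →+* ℂ)) = τ s • (⟨0, (τ s)⁻¹ • s'⟩ : (j : Fin 3) × (K j →+* ℂ)) by
      rw [CMAlgebra.smul_sigma_mk, smul_inv_smul], Finset.smul_mem_smul_finset_iff, hSp, inv_smul_eq_iff, hτ]
  have hinj : Set.InjOn (fun s : K 0 →+* ℂ => τ s • S) Set.univ := by
    intro s _ s' _ h
    have h1 : (⟨0, s⟩ : (j : Fin 3) × (K j →+* ℂ)) ∈ τ s' • S := by
      rw [← show τ s • S = τ s' • S from h]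
      exact (hmem s s).2 rfl
    exact (hmem s' s).1 h1
  have h := Set.ncard_le_ncard_of_injOn (fun s : K 0 →+* ℂ => τ s • S) (fun s _ => smul_finset_mem_diff hsep hS (τ s))
    hinj
  rwa [Set.ncard_univ, Nat.card_eq_fintype_card, Embeddings.card, h4₀] at h

end Triple

/-! ### §3 On abelian varieties: `dim B² − dim D² ≥ 4` on `S₁ × S₂ × S₁′` -/

section Geometry

variable {K : Fin 3 → Type} [∀ j, Field (K j)] [∀ j, NumberField (K j)] [∀ j, IsCMField (K j)]
  {Φ : ∀ j, CMType (K j)} {A : Fin 3 → AbelianVariety ℂ} {ι : ∀ j, 𝓞 (K j) →+* End (A j)}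
  {θ : ∀ j, K j →+* Module.End ℂ (complexBetti (A j).X 1)}

/-- **At least four independent exceptional `(2,2)`-classes on the dihedral surface triple**:
`dim_ℂ D²(S₁ × S₂ × S₁′) ⊗ ℂ + 4 ≤ dim_ℂ B²(S₁ × S₂ × S₁′) ⊗ ℂ` for every family of realisations (White's count
`finrank_hodgeClassSpan_sub_finrank_divisorClassesSpan_biproduct`, by name; the toy census has equality, `19 = 15 + 4`).
[cite: Pohlmann1968, Thm. 1] [cite: Gordon1999HodgeAVSurvey, 9.2.2] [cite: MoonenZarhin1999LowDim, "Hodge groups of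
simple abelian surfaces of CM-type"] -/
theorem four_le_finrank_hodgeClassSpan_sub (h4₀ : Module.finrank ℚ (K 0) = 4) (hK₀ : ¬IsGalois ℚ (K 0))
    (h4₁ : Module.finrank ℚ (K 1) = 4) (hK₁ : ¬IsGalois ℚ (K 1))
    (hMK : ∀ (t : K 1 →+* ℂ) (y : K 1), t y ∈ normalClosure ℚ (K 0) ℂ) (hne : IsEmpty (K 1 →+* K 0))
    (e : K 2 ≃+* K 0) (hsep : CMAlgebra.IsSeparatingFamily Φ)
    (hA : ∀ j, IsCMTypeRealisation (Φ j) (A j) (ι j) (θ j)) :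
    Module.finrank ℂ ↥(divisorClassesSpan (⨁ A).X (⨁ A).dim 2) + 4 ≤
      Module.finrank ℂ ↥(hodgeClassSpan (⨁ A).dim (⨁ A).X 2) := by
  have h := finrank_hodgeClassSpan_sub_finrank_divisorClassesSpan_biproduct hA 2
  have h4 := four_le_ncard_diff_two h4₀ hK₀ h4₁ hK₁ hMK hne e hsep
  omega

end Geometry

end DihedralReflexTriple

end Summit.HodgeConjecture.CorCM

end
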